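import Literature.Probability.Percolation.PercolationSteepness
import Literature.Probability.Percolation.CorrelationLengthDKTProofs
import Literature.Probability.Percolation.MeanFieldBeta
import Summits.CriticalPhenomena.PercolationContinuityZ3.Theorems.PercNearOneGluingNoHeavyQuantPassageTimeDefs
import Summits.CriticalPhenomena.PercolationContinuityZ3.Theorems.PercNearOneGluingNoHeavyQuantOneArmLevelOne
import HarnessLib

/-!
# QUANT lane (p4 gen 20): EXPONENTIAL STEEPNESS FOR THE ONE-ARM PROBABILITY — `θ_n' ≥ θ_n·E_p[T_n]/(p(1−p))`
# with `T_n` the Bernoulli first-passage time from `0` to `∂Λ_n`; `θ_n(r) ≤ θ_n(s)·exp(−4(s−r)E_s[T_n])`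

builds on p205010 (kernel theorem, internal audit signed; external expert review pending) — NOT used in this file
(the companion `…QuantPassageTimeCritical` uses it to show `ρ = ∞` a.s. at `p_c`).

Seat `prim-quant-p4` (METHOD = differential inequalities for `θ` near `p_c`), helper file `--supports
stmt-CriticalPhenomena-4575`; pure proofs, no definitions (objects: `…QuantPassageTimeDefs`: `passTimeLE d n k = {T_n ≤ k}`,
`meanPassTime d n p = E_p[T_n]`, `rhoLE d k = {ρ ≤ k} = ⋂_n {T_n ≤ k}`, `meanRhoUpTo d K p = Σ_{k<K} P_p(ρ > k)`).
Notation: `θ_n(r) = DCT16.thetaN d n r = P_r(0 ↔ ∂Λ_n)`, `F_n = edgesIn (zdGraph d) (box d n)` (lattice edges inside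
`Λ_n`), `A_n = DKT20.armEvent 0 n`, `θ(r) = θ(projIcc r)`, `p_c = criticalProb (zdGraph d) 0`.

The input is Grimmett–Piza's exponential steepness `d/dp log P_p(A) ≥ E_p[H_A]/(p(1−p))` (Grimmett 2006 Thm. (2.53);
tree: `Literature/Probability/Percolation/PercolationSteepness.lean`, this generation) for the arm event `A_n`, whose
Hamming distance `H_{A_n}` is the first-passage time `T_n = T(0, ∂Λ_n)` of FIRST-PASSAGE PERCOLATION with Bernoulli
passage times `t_e = 𝟙[e closed]` (Grimmett 2006 §3.5; Kesten 1986; Auffinger–Damron–Hanson 2017 §3.7.1):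

* §1 `passTimeLE_anti` (`{T_n ≤ k}` decreases in `n`: first exit from `Λ_m`), `passTimeLE_eq_univ_of_le` (`T_n ≤ n`: open the
  axis), measurability;
* §2 **`thetaN_mul_meanPassTime_le_deriv`**: `θ_n(r)·E_r[T_n] ≤ r(1−r)·θ_n'(r)` for every `d`, `n`, `r ∈ (0,1)`; integrated:
  **`thetaN_le_thetaN_mul_exp`**: `θ_n(r) ≤ θ_n(s)·exp(−4(s−r)E_s[T_n])` (`0 < r ≤ s < 1`), i.e.
  `E_s[T_n] ≤ log(θ_n(s)/θ_n(r))/(4(s−r))` (`meanPassTime_le_log_div`);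
* (sequel `…QuantPassageTimeSupercritical`) the passage time to infinity `ρ`: `E_s[ρ] ≤ log(θ(s)/θ(r))/(4(s−r))
  ≤ log(1/(r−p_c))/(4(s−r))` for `p_c < r < s < 1`, `E_{p_c+t}[ρ] ≤ log(2/t)/(2t)`.

HONEST STATUS.  The steepness inequality is a REPRODUCTION (Grimmett–Piza 1997 / Grimmett 2006 Thm. (2.53)); its one-arm
reading and the bounds on `E[ρ]` are bookkeeping on it + the tree (`θ ≤ θ_n`, `θ_n → θ`, `θ(r) ≥ r − p_c`).  That
`T(0,x)` is stochastically bounded above `p_c` is classical (Zhang 1995; ADH 2017 §3.7.1); the finite mean with an explicit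
bound in terms of `θ` seems not to be stated in print (presearch in P4-MODULUS §25).  For `θ` itself the inequality
`θ' ≥ θ·E[ρ]/(p(1−p))` is DOMINATED near `p_c` by Duminil-Copin–Tassion's `θ' ≥ (1−θ)/(p(1−p))` (tree) and near `p = 1` by the
dual (2.40) bound of gen 19 — it is recorded as a tool, not as progress on the modulus (T2).  No rate at `p_c`; (T1)/(T2)
unchanged.

## References
* G. Grimmett, *The Random-Cluster Model* (2006), §2.5 Thm. (2.53), (2.54)–(2.56); §3.5 [GrimmettRandomCluster2006].
* G. R. Grimmett, M. S. T. Piza, Comm. Math. Phys. 189 (1997) 465–480 [GrimmettPiza1997].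
* A. Auffinger, M. Damron, J. Hanson, *50 Years of First-Passage Percolation* (2017), §3.7.1 [AuffingerDamronHanson2017].
* Y. Zhang, Stoch. Proc. Appl. 59 (1995) 251–266 [ZhangSupercriticalFPP1995].
* H. Duminil-Copin, V. Tassion, Enseign. Math. 62 (2016), Thm. 1.1 [DuminilCopinTassionEM2016].
-/

noncomputable section

namespace Summit.CriticalPhenomena.PercolationContinuityZ3.Theorems

namespace PassTime

open MeasureTheory Set Filter Literature.Probability.Percolation Literature.Probability.LatticeModels
open scoped Classical Topology

variable {d : ℕ}

/-! ### §0. Unfolding the definitions -/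

/-- `{T_n ≤ k}` is the layer-cake event `withinDist F_n A_n k` of the steepness file. -/
theorem passTimeLE_eq (d n k : ℕ) :
    passTimeLE d n k = Steepness.withinDist (edgesIn (zdGraph d) (box d n)) (DKT20.armEvent (d := d) 0 n) k := rfl

/-- `E_p[T_n]` is `meanHamDist` of the arm event. -/
theorem meanPassTime_eq (d n : ℕ) (p : unitInterval) :
    meanPassTime d n p =
      Steepness.meanHamDist (zdGraph d) (edgesIn (zdGraph d) (box d n)) (DKT20.armEvent (d := d) 0 n) p := rfl

/-- The real parameter `r ∈ [0,1]` read back from `Set.projIcc 0 1`. -/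
private theorem coe_projIcc_of_mem {r : ℝ} (h0 : 0 ≤ r) (h1 : r ≤ 1) :
    ((Set.projIcc (0 : ℝ) 1 zero_le_one r : unitInterval) : ℝ) = r :=
  congrArg Subtype.val (Set.projIcc_of_mem zero_le_one ⟨h0, h1⟩)

/-! ### §1. The events `{T_n ≤ k}` -/

/-- `{T_n ≤ k}` is increasing. -/
theorem isUpperSet_passTimeLE (d n k : ℕ) : IsUpperSet (passTimeLE d n k) :=
  Steepness.isUpperSet_withinDist (DKT20.isUpperSet_armEvent 0 n) k

/-- `{T_n ≤ k}` is determined by the lattice edges inside `Λ_n`. -/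
theorem determinedBy_passTimeLE (d n k : ℕ) :
    DeterminedBy (passTimeLE d n k) (↑(edgesIn (zdGraph d) (box d n)) : Set (Sym2 (Site d))) :=
  Steepness.determinedBy_withinDist (DKT20.determinedBy_armEvent 0 n) k

/-- `{T_n ≤ k}` is measurable. -/
theorem measurableSet_passTimeLE (d n k : ℕ) : MeasurableSet (passTimeLE d n k) :=
  (determinedBy_passTimeLE d n k).measurableSet_of_finset

/-- `{T_n ≤ k}` grows with `k`. -/
theorem passTimeLE_mono_right {n k k' : ℕ} (hkk : k ≤ k') : passTimeLE d n k ⊆ passTimeLE d n k' :=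
  Steepness.withinDist_mono hkk

/-- For a configuration of lattice edges, the lattice-step arm event `A_m = armEvent 0 m` is the one-arm event
`{0 ↔ ∂Λ_m}`. -/
theorem armEvent_zero_iff_siteToBoundary {η : BondConfig (Site d)} (hη : η ⊆ (zdGraph d).edgeSet) (m : ℕ) :
    η ∈ DKT20.armEvent (d := d) 0 m ↔ η ∈ siteToBoundary d m := by
  simp only [DKT20.armEvent, AKN.Reaches, box_zero_eq, Finset.mem_singleton, exists_eq_left, Set.mem_setOf_eq,
    siteToBoundary]
  constructor
  · rintro ⟨w, hw, hwx⟩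
    exact ⟨w, hw, (DKT20.openConnIn_iff_openClusterIn (zero_mem_box d m) hη w).2 hwx⟩
  · rintro ⟨w, hw, hwx⟩
    exact ⟨w, hw, (DKT20.openConnIn_iff_openClusterIn (zero_mem_box d m) hη w).1 hwx⟩

/-- Membership in `A_m` is decided by the lattice part of the configuration. -/
theorem mem_armEvent_iff_inter (ω : BondConfig (Site d)) (m : ℕ) :
    ω ∈ DKT20.armEvent (d := d) 0 m ↔ ω ∩ (zdGraph d).edgeSet ∈ DKT20.armEvent (d := d) 0 m := by
  have h := (determinedBy_iff _ _).1 (DKT20.determinedBy_armEvent (d := d) 0 m) ω (ω ∩ (zdGraph d).edgeSet)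
  refine h ?_
  rw [Set.inter_assoc, Set.inter_eq_right.2 (DKT20.coe_edgesIn_subset m)]

/-- First exit (set version of `real_siteToBoundary_antitone`): for `ω ⊆ E(ℤ^d)` and `m ≤ n`, `0 ↔ ∂Λ_n` implies
`0 ↔ ∂Λ_m`. -/
-- adapted from Literature/Probability/Percolation/SharpnessDCTProofs.lean (`real_siteToBoundary_antitone`)
private theorem mem_siteToBoundary_of_le {ω : BondConfig (Site d)} (hω : ω ⊆ (zdGraph d).edgeSet)
    {m n : ℕ} (hmn : m ≤ n) (h : ω ∈ siteToBoundary d n) : ω ∈ siteToBoundary d m := by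
  rw [DCT16.mem_siteToBoundary_iff] at h
  obtain ⟨y, hy, hpath⟩ := h
  rw [← DCT16.armEvent_zero]
  refine DCT16.armEvent_of_pathIn hω hpath ?_
  rcases hmn.lt_or_eq with hlt | rfl
  · exact Or.inl (by rw [sub_zero]; exact DCT16.notMem_box_of_mem_innerBoundary_box hlt hy)
  · exact Or.inr (by rw [sub_zero]; exact hy)

/-- **`A_n ⊆ A_m` for `m ≤ n`** (the lattice-step arm events decrease in the radius, for EVERY configuration). -/
theorem armEvent_zero_anti {m n : ℕ} (hmn : m ≤ n) : DKT20.armEvent (d := d) 0 n ⊆ DKT20.armEvent (d := d) 0 m := by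
  intro ω hω
  rw [mem_armEvent_iff_inter] at hω ⊢
  have hη : ω ∩ (zdGraph d).edgeSet ⊆ (zdGraph d).edgeSet := Set.inter_subset_right
  rw [armEvent_zero_iff_siteToBoundary hη] at hω ⊢
  exact mem_siteToBoundary_of_le hη hmn hω

/-- **`{T_n ≤ k} ⊆ {T_m ≤ k}` for `m ≤ n`**: the first-passage times `T_n` increase with `n` (open the same edges,
discarding those outside `Λ_m`). -/
theorem passTimeLE_anti {m n : ℕ} (hmn : m ≤ n) (k : ℕ) : passTimeLE d n k ⊆ passTimeLE d m k :=
  Steepness.withinDist_subset_withinDist (armEvent_zero_anti hmn) (DKT20.determinedBy_armEvent 0 m) k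

/-- **The axis**: the `n` edges `{j e₀, (j+1) e₀}`, `0 ≤ j < n`, lie inside `Λ_n` and, once open, join `0` to
`n e₀ ∈ ∂Λ_n` — so `T_n ≤ n` everywhere (`d ≥ 1`). -/
theorem exists_axis (hd : 1 ≤ d) (n : ℕ) :
    ∃ S : Finset (Sym2 (Site d)), S ⊆ edgesIn (zdGraph d) (box d n) ∧ S.card ≤ n ∧
      ∀ ω : BondConfig (Site d), ω ∪ ↑S ∈ DKT20.armEvent (d := d) 0 n := by
  set v : ℤ → Site d := fun k => Pi.single (⟨0, hd⟩ : Fin d) k with hv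
  set S : Finset (Sym2 (Site d)) := (Finset.range n).image fun k : ℕ => s(v k, v ((k : ℤ) + 1)) with hS
  have hSE : (S : Set (Sym2 (Site d))) ⊆ (zdGraph d).edgeSet := by
    intro e he
    rw [hS, Finset.coe_image, Set.mem_image] at he
    obtain ⟨k, -, rfl⟩ := he
    exact (SimpleGraph.mem_edgeSet _).2 (DKT20.axisPt_adj hd k)
  have hSF : S ⊆ edgesIn (zdGraph d) (box d n) := by
    intro e he
    rw [hS, Finset.mem_image] at he
    obtain ⟨k, hk, rfl⟩ := he
    rw [Finset.mem_range] at hk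
    rw [mem_edgesIn_iff]
    refine ⟨(SimpleGraph.mem_edgeSet _).2 (DKT20.axisPt_adj hd k), fun x hx => ?_⟩
    rcases Sym2.mem_iff.1 hx with rfl | rfl
    · exact DKT20.axisPt_mem_box hd hk.le
    · have := DKT20.axisPt_mem_box hd (Nat.succ_le_of_lt hk)
      push_cast at this
      exact this
  refine ⟨S, hSF, (Finset.card_image_le).trans (Finset.card_range n).le, fun ω => ?_⟩
  -- the lattice part `η` of `ω ∪ S` contains the axis, hence lies in `{0 ↔ ∂Λ_n}`
  set η : BondConfig (Site d) := (ω ∪ ↑S) ∩ (zdGraph d).edgeSet with hη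
  have hηE : η ⊆ (zdGraph d).edgeSet := Set.inter_subset_right
  have hSη : (S : Set (Sym2 (Site d))) ⊆ η := fun e he => ⟨Or.inr he, hSE he⟩
  rw [mem_armEvent_iff_inter, armEvent_zero_iff_siteToBoundary hηE, DCT16.mem_siteToBoundary_iff]
  refine ⟨v n, DKT20.axisPt_mem_innerBoundary hd n, ?_⟩
  have key : ∀ k : ℕ, k ≤ n → PathIn (openGraph η) (↑(box d n)) 0 (v k) := by
    intro k
    induction k with
    | zero =>
      intro _
      have h0 : v ((0 : ℕ) : ℤ) = 0 := by rw [hv]; simp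
      rw [h0]
      exact PathIn.refl (Finset.mem_coe.2 (zero_mem_box d n))
    | succ k ih =>
      intro hk
      have hk' : k < n := Nat.lt_of_succ_le hk
      refine (ih hk'.le).tail ?_ ?_
      · rw [openGraph_adj]
        refine ⟨hSη ?_, (DKT20.axisPt_adj hd k).ne.trans_eq ?_⟩
        · rw [hS, Finset.coe_image]
          refine ⟨k, Finset.mem_coe.2 (Finset.mem_range.2 hk'), ?_⟩
          simp [hv]
        · simp [hv]
      · have := DKT20.axisPt_mem_box hd hk
        push_cast at this
        exact Finset.mem_coe.2 this
  exact key n le_rfl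

/-- **`T_n ≤ n`**: `{T_n ≤ k} = Ω` for `k ≥ n` (`d ≥ 1`). -/
theorem passTimeLE_eq_univ_of_le (hd : 1 ≤ d) {n k : ℕ} (hk : n ≤ k) : passTimeLE d n k = Set.univ := by
  obtain ⟨S, hSF, hSn, hS⟩ := exists_axis hd n
  exact Set.eq_univ_of_forall fun ω => ⟨S, hSF, hSn.trans hk, hS ω⟩

/-- **`T_n ≤ |F_n|`**: `{T_n ≤ k} = Ω` for `k ≥ |F_n|` (`d ≥ 1`). -/
theorem passTimeLE_eq_univ_of_card_le (hd : 1 ≤ d) {n k : ℕ} (hk : (edgesIn (zdGraph d) (box d n)).card ≤ k) :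
    passTimeLE d n k = Set.univ := by
  obtain ⟨S, hSF, -, hS⟩ := exists_axis hd n
  exact Set.eq_univ_of_forall fun ω => ⟨S, hSF, (Finset.card_le_card hSF).trans hk, hS ω⟩

/-- `0 ≤ P_p(T_n > k) = 1 − P_p(T_n ≤ k)`. -/
theorem one_sub_real_passTimeLE_nonneg (p : unitInterval) (n k : ℕ) :
    0 ≤ 1 - (bondPercolation (zdGraph d) p).real (passTimeLE d n k) := by
  linarith [measureReal_le_one (μ := bondPercolation (zdGraph d) p) (s := passTimeLE d n k)]

/-- **Partial sums are dominated by `E_p[T_n]`**: `Σ_{k<K} P_p(T_n > k) ≤ E_p[T_n]` for every `K` (the terms with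
`k ≥ |F_n|` vanish since `T_n ≤ |F_n|`; `d ≥ 1`). -/
theorem sum_le_meanPassTime (hd : 1 ≤ d) (p : unitInterval) (n K : ℕ) :
    ∑ k ∈ Finset.range K, (1 - (bondPercolation (zdGraph d) p).real (passTimeLE d n k)) ≤ meanPassTime d n p := by
  unfold meanPassTime
  set N := (edgesIn (zdGraph d) (box d n)).card with hN
  calc ∑ k ∈ Finset.range K, (1 - (bondPercolation (zdGraph d) p).real (passTimeLE d n k))
      ≤ ∑ k ∈ Finset.range (max K N), (1 - (bondPercolation (zdGraph d) p).real (passTimeLE d n k)) :=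
        Finset.sum_le_sum_of_subset_of_nonneg (Finset.range_mono (le_max_left K N))
          fun k _ _ => one_sub_real_passTimeLE_nonneg p n k
    _ = ∑ k ∈ Finset.range N, (1 - (bondPercolation (zdGraph d) p).real (passTimeLE d n k)) := by
        rw [← Finset.sum_range_add_sum_Ico _ (le_max_right K N)]
        have h0 : ∑ k ∈ Finset.Ico N (max K N), (1 - (bondPercolation (zdGraph d) p).real (passTimeLE d n k)) = 0 := by
          refine Finset.sum_eq_zero fun k hk => ?_
          rw [Finset.mem_Ico] at hk
          rw [passTimeLE_eq_univ_of_card_le hd hk.1, probReal_univ, sub_self]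
        rw [h0, add_zero]

/-- `E_p[T_n] ≤ n` (`d ≥ 1`). -/
theorem meanPassTime_le (hd : 1 ≤ d) (p : unitInterval) (n : ℕ) : meanPassTime d n p ≤ n := by
  unfold meanPassTime
  set N := (edgesIn (zdGraph d) (box d n)).card with hN
  calc ∑ k ∈ Finset.range N, (1 - (bondPercolation (zdGraph d) p).real (passTimeLE d n k))
      ≤ ∑ k ∈ Finset.range (max N n), (1 - (bondPercolation (zdGraph d) p).real (passTimeLE d n k)) :=
        Finset.sum_le_sum_of_subset_of_nonneg (Finset.range_mono (le_max_left N n))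
          fun k _ _ => one_sub_real_passTimeLE_nonneg p n k
    _ = ∑ k ∈ Finset.range n, (1 - (bondPercolation (zdGraph d) p).real (passTimeLE d n k)) := by
        rw [← Finset.sum_range_add_sum_Ico _ (le_max_right N n)]
        have h0 : ∑ k ∈ Finset.Ico n (max N n), (1 - (bondPercolation (zdGraph d) p).real (passTimeLE d n k)) = 0 := by
          refine Finset.sum_eq_zero fun k hk => ?_
          rw [Finset.mem_Ico] at hk
          rw [passTimeLE_eq_univ_of_le hd hk.1, probReal_univ, sub_self]
        rw [h0, add_zero]
    _ ≤ ∑ _k ∈ Finset.range n, (1 : ℝ) := Finset.sum_le_sum fun k _ => sub_le_self _ measureReal_nonneg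
    _ = n := by simp

/-- `0 ≤ E_p[T_n]`. -/
theorem meanPassTime_nonneg (p : unitInterval) (n : ℕ) : 0 ≤ meanPassTime d n p :=
  Finset.sum_nonneg fun k _ => one_sub_real_passTimeLE_nonneg p n k

/-! ### §2. Exponential steepness for the one-arm probability -/

/-- **Steepness for `θ_n` (`HasDerivAt` form)**: for every `d`, `n` and `r ∈ (0,1)`, `θ_n` is differentiable at `r` with
derivative `D = Σ_{e ∈ F_n} P_r(e pivotal for A_n) ≥ 0`, and `θ_n(r) · E_r[T_n] ≤ r(1−r) · D`; i.e.
`d/dr log θ_n(r) ≥ E_r[T_n]/(r(1−r))` (Grimmett 2006 (2.54) for `A_n`). -/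
theorem hasDerivAt_thetaN_mul_meanPassTime_le (n : ℕ) {r : ℝ} (hr : r ∈ Set.Ioo (0 : ℝ) 1) :
    ∃ D : ℝ, HasDerivAt (DCT16.thetaN d n) D r ∧ 0 ≤ D ∧
      DCT16.thetaN d n r * meanPassTime d n (Set.projIcc 0 1 zero_le_one r) ≤ r * (1 - r) * D := by
  have hF := DKT20.coe_edgesIn_subset (d := d) n
  have hA := DKT20.isUpperSet_armEvent (d := d) 0 n
  have hAF := DKT20.determinedBy_armEvent (d := d) 0 n
  obtain ⟨hderiv, hle⟩ := Steepness.real_mul_meanHamDist_le_deriv hF hA hAF hr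
  have hfun : (fun q : ℝ => (bondPercolation (zdGraph d) (Set.projIcc 0 1 zero_le_one q)).real (DKT20.armEvent 0 n)) =
      DCT16.thetaN d n := funext fun q => OneArmLevelOne.real_armEvent_zero_eq_thetaN n q
  rw [hfun] at hderiv
  rw [OneArmLevelOne.real_armEvent_zero_eq_thetaN n r] at hle
  exact ⟨_, hderiv, Finset.sum_nonneg fun e _ => measureReal_nonneg, hle⟩

/-- **Steepness for `θ_n`**: `θ_n(r) · E_r[T_n] ≤ r(1−r) · θ_n'(r)` for every `d`, `n`, `r ∈ (0,1)`. -/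
theorem thetaN_mul_meanPassTime_le_deriv (n : ℕ) {r : ℝ} (hr : r ∈ Set.Ioo (0 : ℝ) 1) :
    DCT16.thetaN d n r * meanPassTime d n (Set.projIcc 0 1 zero_le_one r) ≤ r * (1 - r) * deriv (DCT16.thetaN d n) r := by
  obtain ⟨D, hD, -, hle⟩ := hasDerivAt_thetaN_mul_meanPassTime_le (d := d) n hr
  rw [hD.deriv]; exact hle

/-- **Integrated steepness for `θ_n`** (Grimmett 2006 (2.56) for `A_n`): for every `d`, `n` and `0 < r ≤ s < 1`,
`θ_n(r) ≤ θ_n(s) · exp(−4(s−r) · E_s[T_n])`. -/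
theorem thetaN_le_thetaN_mul_exp (n : ℕ) {r s : ℝ} (hr : 0 < r) (hrs : r ≤ s) (hs : s < 1) :
    DCT16.thetaN d n r ≤ DCT16.thetaN d n s * Real.exp (-4 * (s - r) * meanPassTime d n (Set.projIcc 0 1 zero_le_one s)) := by
  have h := Steepness.real_le_real_mul_exp (DKT20.coe_edgesIn_subset (d := d) n) (DKT20.isUpperSet_armEvent 0 n)
    (DKT20.determinedBy_armEvent 0 n) hr hrs hs
  rwa [OneArmLevelOne.real_armEvent_zero_eq_thetaN n r, OneArmLevelOne.real_armEvent_zero_eq_thetaN n s] at h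

/-- **`E_s[T_n] ≤ log(θ_n(s)/θ_n(r))/(4(s−r))`** for `d ≥ 1`, every `n ≥ 0` and `0 < r < s < 1`. -/
theorem meanPassTime_le_log_div (hd : 1 ≤ d) (n : ℕ) {r s : ℝ} (hr : 0 < r) (hrs : r < s) (hs : s < 1) :
    meanPassTime d n (Set.projIcc 0 1 zero_le_one s) ≤
      Real.log (DCT16.thetaN d n s / DCT16.thetaN d n r) / (4 * (s - r)) := by
  have h := thetaN_le_thetaN_mul_exp (d := d) n hr hrs.le hs
  have hθr : 0 < DCT16.thetaN d n r :=
    DKT20.real_siteToBoundary_pos hd _ (by rw [coe_projIcc_of_mem hr.le (hrs.le.trans hs.le)]; exact hr) n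
  have hθs : 0 < DCT16.thetaN d n s :=
    DKT20.real_siteToBoundary_pos hd _ (by rw [coe_projIcc_of_mem (hr.le.trans hrs.le) hs.le]; exact hr.trans hrs) n
  set M := meanPassTime d n (Set.projIcc 0 1 zero_le_one s) with hM
  have h4 : 0 < 4 * (s - r) := by linarith
  rw [le_div_iff₀ h4, Real.le_log_iff_exp_le (div_pos hθs hθr), le_div_iff₀ hθr]
  calc Real.exp (M * (4 * (s - r))) * DCT16.thetaN d n r
      ≤ Real.exp (M * (4 * (s - r))) * (DCT16.thetaN d n s * Real.exp (-4 * (s - r) * M)) :=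
        mul_le_mul_of_nonneg_left h (Real.exp_pos _).le
    _ = DCT16.thetaN d n s := by
        rw [mul_comm, mul_assoc, ← Real.exp_add, show -4 * (s - r) * M + M * (4 * (s - r)) = 0 by ring,
          Real.exp_zero, mul_one]

end PassTime

end Summit.CriticalPhenomena.PercolationContinuityZ3.Theorems

end
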